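/-
Copyright (c) 2026 the pub-hodgecm-mathlib formalisation cell (harness21).  Prover seat hodgecm-mathlib-K2E1-p16 (g4), Track B ∕ K2-LIT, h413 = `stmt-HodgeConjecture-24833`,
R90-TF section S8 «ContSpec-n½», socket (E) :276 (N₃) row, S8 dealer R90-CS-plan (g3) S8-R241 (3) ∕ S8-R245 J-S8-E16 («default = incl. FILE B if it is the (N₃) `dim τ > 1` glue»):
FILE B of the χ_τ-IDEMPOTENT EDITION — ★ p862453 §1 `subrep_le_orthogonal_of_lineModel_cm` and ★ `resG_isotypic_le_orthogonal_of_lineModel` ∕ `_lines` (K2E1-p12 (g4)) with the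
multiplicativity letters `(hχmul, hχone)` REPLACED by CONVOLUTION IDEMPOTENCE `hχconv` (FILE A `R90S8ResGIsotypicTauIdempotentModelU3`), so the (N₃) per-`K_∞`-type letter `hτ` of
★ `hNblk_of_kTypes` is payable at `χ := χ_τ♮ = dim τ • conj χ_τ` for `K_∞`-types of ANY dimension.
-/
import Summits.HodgeConjecture.HodgeConjecture.Theorems.R90S8ResGIsotypicTauIdempotentModelU3     -- ★ FILE A (this seat): `cm_blockProjector_hPV_of_conv`, `lpModel_blockProj_eq_zero_of_irreducible_subrep_cm_of_conv`, `tauIdem_mulConv`, `tauIdem_conj_inv`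
import Summits.HodgeConjecture.HodgeConjecture.Theorems.R90S8ResGIsotypicVectorsAreResiduesU3      -- ★ p862541-road (K2E1-p12 (g4)): the multiplicative editions; brings ★ p862453 §1, ★ G-DEFS `resGBlock ∕ resGAtom ∕ resGLine`, ★ `residualSubspace`
import HarnessLib

/-!
# R90-TF · S8 «ContSpec-n½» — `R90S8ResGIsotypicTauLinesU3`: THE χ_τ-IDEMPOTENT EDITION, FILE B — «AN IRREDUCIBLE OF `L²` IS ORTHOGONAL TO THE LINE SPACE OF THE τ-CUT BLOCK» (every `N` at
# `cmDatum`; the (N_blk,₃) clauses at Mok's `U(J₃) = quasiSplit L⁺ L c 3`), CONVOLUTION IDEMPOTENCE IN PLACE OF MULTIPLICATIVITY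

Cell `hodgecm-mathlib`, crux H413 (`stmt-HodgeConjecture-24833`, lane `--supports … --as helper`), route of record `HCCMUnconditional`; R90-TF section S8, socket (E) `sock_S8_res_exhaustion_le_closure`
(B ED. 7 :276), (N₃) row PAID PER `K_∞`-TYPE τ and glued (★ `R90S8ResGIsotypicKTypeGlueU3.hNblk_of_kTypes`; K-TYPE CURRENCY FLAG S8-R189; CENSUS-E4 row (1)).  THEOREMS ONLY (no `def`, no
`instance`, no `notation`, no named-fact hypothesis, no `sorry`; default heartbeats); count-neutral; CLOSES NO SOCKET; pays no letter by itself.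

WHAT THIS FILE DOES.  FILE A proved that in the D5′ chain `(hχmul, hχone)` are used ONLY for `P_χ ∘L P_χ = P_χ`, which follows from the weaker CONVOLUTION IDEMPOTENCE
`hχconv : ∀ x, χ x = mulConv μK χ χ x` — satisfied by multiplicative `χ` (★ `mulConv_eq_self_of_mul`) AND by the χ_τ-idempotent `χ_τ♮ := dim τ • conj χ_τ` of an irreducible unitary
`K_∞`-type `τ` of any dimension (★ `tauIdem_mulConv`; `hχinv` ★ `tauIdem_conj_inv`) — and re-ran ★ D5′-cm on `hχconv`.  Here the three consumers one level up are re-keyed the same way,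
STATEMENTS = ★'s BYTE FOR BYTE except `(hχmul : …) (hχone : …)` ↦ `(hχconv : ∀ x, χ x = mulConv μK χ χ x)` and the frame gains `[IsTopologicalGroup K] [SecondCountableTopology K]` (needed by ★
`integratedOperator_comp_integratedOperator`; `[MeasurableMul K]` becomes automatic and is dropped), BODIES = ★'s with the two D5′ calls re-pointed to FILE A:
* §1 (every `N`, every `H`, any unitary strongly continuous `π` of `U(H)(𝔸_{L⁺}) = (cmDatum L N H).Adelic`) **`subrep_le_orthogonal_of_lineModel_cm_of_conv`** — ★ p862453 §1: D5′'s letters +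
  the line-space interface (N-iface) `hLnP hLnU` ⊢ `W.toSubmodule ≤ Lnᗮ` for every irreducible closed `W`.
* §2 (Mok's `U(J₃)`, arbitrary `𝔓`, `(K′, ω)`, `Ln`) **`resG_isotypic_le_orthogonal_of_lineModel_of_conv`** — the (N_blk,₃) clause of ★ F1_qs `residualG_le_topologicalClosure_of_letters_quasiSplit`.
* §3 **`resG_isotypic_le_orthogonal_lines_of_conv`** — the same BY NAME at the line space of record `resGLine L μ U′ K′ ω χ₁ χ₂` (★ G-DEFS), interface discharged, visible `hScP`, `hUker`.
CONSUMER SHAPE.  At a `K_∞`-type `τ` (irreducible, unitary, continuous, on `E`): take `χ : C_c(K_∞, ℂ)` with `χ k = dim E * conj χ_τ(k)` (★ `exists_compactlySupported_tauIdem`),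
`hχconv := tauIdem_mulConv μK τ hτc hτu hχτ`, `hχinv := tauIdem_conj_inv τ hτu hχτ`; the block projector `P = R_K(χ_τ♮) ∘L R_f(e)` then cuts the τ-isotypic part of the level block
(`hScP` for the τ-cut block: F0P2-p10 (g4) `R90S8ResGBlockProjectorFixTauU3.hScP_tauCut_of_record` over FILE A's «`R_K(χ_τ♮) = id` on `N_τ`»), and §3 delivers the (N₃) per-τ letter
`hτ` of ★ `hNblk_of_kTypes` for `dim τ > 1` exactly as ★ `R90S8ResGIsotypicArchLevelBridgeU3` ∕ ★ `R90S8ResGIsotypicLeLinesOfRecordU3` deliver it for one-dimensional types.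
HONEST LABEL: HC_CM is proved only modulo the 7 printed citations (2 remaining named inputs: hLiu418 = `stmt-HodgeConjecture-24832`, h413 = `stmt-HodgeConjecture-24833`) until rung 0
closes; the visible bill per block is D5′'s (data `(κ, μK, χ; e, K′_f)`, `P hPdef`, (L1) `T hT𝓐 hTP hTB`, (L2) model `U s hs hU`, (L3) `hline`) + `hScP`, `hUker` — UNCHANGED but for
`hχconv` in place of `hχmul hχone`; REL ≠ ★ ≠ BUILT; this file asserts no named fact, is conditional by construction on those visible binders, and closes no socket; count-neutral.

## References
* [MoeglinWaldspurger1995] C. Mœglin, J.-L. Waldspurger, *Spectral Decomposition and Eisenstein Series* (1995), I.2.18, IV.3.12 (b), V.3.13, VI.2.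
* [Rogawski1990] J. D. Rogawski, *Automorphic Representations of Unitary Groups in Three Variables* (1990), §13.9 p. 229.
* [DeitmarEchterhoff2014] A. Deitmar, S. Echterhoff, *Principles of Harmonic Analysis* (2014), Lemma 6.1.7, Prop. 6.2.1, Prop. 7.3.3.
* [BrockerTomDieck1985] T. Bröcker, T. tom Dieck, *Representations of Compact Lie Groups*, GTM 98 (1985), II (4.16), III (5.10).
* [ReedSimonI1980] M. Reed, B. Simon, *Methods of Modern Mathematical Physics I* (1980), Thm. II.3, Thm. VII.2.
-/

set_option autoImplicit false
set_option linter.dupNamespace false  -- the mandated namespace `…HodgeConjecture.HodgeConjecture.R90.S8` (LEAD #1 L1) repeats the summit's segment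

noncomputable section

open MeasureTheory Filter Topology CompactlySupported NumberField ContRepresentation Set
open scoped InnerProductSpace ENNReal ComplexConjugate
open Literature.NumberTheory.Automorphic Literature.NumberTheory.Automorphic.UnitaryGroup Literature.NumberTheory.GaloisRepresentations AdelicGroupData
open Literature.NumberTheory.Automorphic.Arthur2013.Leaves.TECR
open Summit.HodgeConjecture.HodgeConjecture.Cruxes.H413.K2E1CuspidalSpectrumUnitary (residualSubspace)
open Summit.HodgeConjecture.HodgeConjecture.Cruxes.H413.K2E1HeckeAlgebraLettersCM

namespace Summit.HodgeConjecture.HodgeConjecture.R90.S8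

/-! ## §1 Every `N`, every `H`: an irreducible closed subrepresentation of `L²(U(H))` is orthogonal to any line space detected by the D5′ line coordinate — CONVOLUTION EDITION -/

section Generic

variable {L : Type} [Field L] [NumberField L] [IsCMField L] {N : ℕ} {H : Matrix (Fin N) (Fin N) L}
  {K V : Type*} [Group K] [TopologicalSpace K] [IsTopologicalGroup K] [MeasurableSpace K] [BorelSpace K] [SecondCountableTopology K]
  [NormedAddCommGroup V] [InnerProductSpace ℂ V] [CompleteSpace V]
  (π : ContRepresentation ℂ (cmDatum L N H).Adelic V) (hu : π.IsUnitary) (hc : π.IsStronglyContinuous)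
  [MeasurableSpace (UnitaryGroup.arch (↥(maximalRealSubfield L)) L (IsCMField.complexConj L) N H)] [BorelSpace (UnitaryGroup.arch (↥(maximalRealSubfield L)) L (IsCMField.complexConj L) N H)]
  [MeasurableSpace (finAdelic (↥(maximalRealSubfield L)) L (IsCMField.complexConj L) N H)] [BorelSpace (finAdelic (↥(maximalRealSubfield L)) L (IsCMField.complexConj L) N H)]
  (νinf : Measure (UnitaryGroup.arch (↥(maximalRealSubfield L)) L (IsCMField.complexConj L) N H)) [IsFiniteMeasureOnCompacts νinf] [νinf.IsMulLeftInvariant] [νinf.IsInvInvariant] [νinf.IsOpenPosMeasure]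
  (νf : Measure (finAdelic (↥(maximalRealSubfield L)) L (IsCMField.complexConj L) N H)) [IsFiniteMeasureOnCompacts νf] [νf.IsMulLeftInvariant] [νf.IsInvInvariant] [νf.IsOpenPosMeasure]
  (κ : K →* UnitaryGroup.arch (↥(maximalRealSubfield L)) L (IsCMField.complexConj L) N H) (hκ : Continuous κ)
  (μK : Measure K) [IsFiniteMeasureOnCompacts μK] [IsProbabilityMeasure μK] [μK.IsMulLeftInvariant] [MeasurableInv K] [μK.IsInvInvariant]
  (χ : C_c(K, ℂ)) (e : C_c(finAdelic (↥(maximalRealSubfield L)) L (IsCMField.complexConj L) N H, ℂ))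
  {Ω : Type*} {mΩ : MeasurableSpace Ω} (m : Measure Ω) {E : Type*} [NormedAddCommGroup E] [NormedSpace ℂ E] {J : Type*} [Countable J]
variable [ENNReal.HolderTriple ∞ 2 2]

/-- **An irreducible closed summand of a unitary representation of `U(H)(𝔸_{L⁺})` is ORTHOGONAL to every line space detected by the D5′ line coordinate — CONVOLUTION EDITION** of ★
p862453 §1 `subrep_le_orthogonal_of_lineModel_cm` (every `N`, every `H`; `π` ANY unitary strongly continuous representation on a Hilbert space `V`): the K-type kernel `χ ∈ C_c(K, ℂ)` is
only assumed CONVOLUTION-IDEMPOTENT (`hχconv`, e.g. `χ := χ_τ♮ = dim τ • conj χ_τ`, ★ `tauIdem_mulConv`) and `*`-symmetric (`hχinv`); everything else — D5′'s data and letters (block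
projector `P = P_χ ∘L π_f(e)` via `hPdef`; (L1) `T, hT𝓐, hTP, hTB`; (L2) `U, s, hs, hU`; (L3) `hline`), the line space `Ln ≤ V_P` (`hLnP`) detected by the line coordinate (`hLnU`) — is
★'s VERBATIM.  THEN `W ⟂ Ln` for every topologically irreducible closed `W ≤ V`: `⟪v, y⟫ = ⟪P v, y⟫ = ⟪v, P y⟫` (★ `cm_blockProjector_hPsa`), `P y ∈ V_P` (★ FILE A
`cm_blockProjector_hPV_of_conv`) and `U (P y) = 0` (★ FILE A D5′-conv). [cite: MoeglinWaldspurger1995, IV.3.12, VI.2] [cite: DeitmarEchterhoff2014, Lemma 6.1.7] [cite: ReedSimonI1980, Thm. II.3] -/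
theorem subrep_le_orthogonal_of_lineModel_cm_of_conv
    (hχconv : ∀ x, χ x = mulConv μK (⇑χ) (⇑χ) x) (hχinv : ∀ k, conj (χ k⁻¹) = χ k)
    (K' : Subgroup (finAdelic (↥(maximalRealSubfield L)) L (IsCMField.complexConj L) N H)) (he0 : ∀ x, x ∉ K' → e x = 0) (he1 : ∫ x, e x ∂νf = 1)
    (heK : ∀ k ∈ K', ∀ x, e (k * x) = e x) (hestar : ∀ x, mulStar (⇑e) x = e x)
    (P : V →L[ℂ] V) (hPdef : P = ((π.restrict ((archToAdelic (↥(maximalRealSubfield L)) L (IsCMField.complexConj L) N H).comp κ)).integratedOperator (hu.restrict _)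
          (hc.restrict _ ((continuous_archToAdelic (↥(maximalRealSubfield L)) L (IsCMField.complexConj L) N H).comp hκ)) μK χ ∘L
        (π.restrict (finAdelicToAdelic (↥(maximalRealSubfield L)) L (IsCMField.complexConj L) N H)).integratedOperator (hu.restrict _) (hc.restrict _ (continuous_finAdelicToAdelic (↥(maximalRealSubfield L)) L (IsCMField.complexConj L) N H)) νf e))
    (T : J → V →L[ℂ] V) (hT𝓐 : ∀ j, T j ∈ {A : V →L[ℂ] V | ∃ (a : C_c(UnitaryGroup.arch (↥(maximalRealSubfield L)) L (IsCMField.complexConj L) N H, ℂ)) (b : C_c(finAdelic (↥(maximalRealSubfield L)) L (IsCMField.complexConj L) N H, ℂ)),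
      A = (π.restrict (archToAdelic (↥(maximalRealSubfield L)) L (IsCMField.complexConj L) N H)).integratedOperator (hu.restrict _) (hc.restrict _ (continuous_archToAdelic (↥(maximalRealSubfield L)) L (IsCMField.complexConj L) N H)) νinf a ∘L
          (π.restrict (finAdelicToAdelic (↥(maximalRealSubfield L)) L (IsCMField.complexConj L) N H)).integratedOperator (hu.restrict _) (hc.restrict _ (continuous_finAdelicToAdelic (↥(maximalRealSubfield L)) L (IsCMField.complexConj L) N H)) νf b})
    (hTP : ∀ j, Commute P (T j))
    (hTB : ∀ j, ∀ A ∈ {A : V →L[ℂ] V | ∃ (a : C_c(UnitaryGroup.arch (↥(maximalRealSubfield L)) L (IsCMField.complexConj L) N H, ℂ)) (b : C_c(finAdelic (↥(maximalRealSubfield L)) L (IsCMField.complexConj L) N H, ℂ)),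
      A = (π.restrict (archToAdelic (↥(maximalRealSubfield L)) L (IsCMField.complexConj L) N H)).integratedOperator (hu.restrict _) (hc.restrict _ (continuous_archToAdelic (↥(maximalRealSubfield L)) L (IsCMField.complexConj L) N H)) νinf a ∘L
          (π.restrict (finAdelicToAdelic (↥(maximalRealSubfield L)) L (IsCMField.complexConj L) N H)).integratedOperator (hu.restrict _) (hc.restrict _ (continuous_finAdelicToAdelic (↥(maximalRealSubfield L)) L (IsCMField.complexConj L) N H)) νf b},
      ∀ x ∈ LinearMap.eqLocus (P : V →ₗ[ℂ] V) LinearMap.id, P (A (T j x)) = T j (P (A x)))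
    (U : V →ₗ[ℂ] Lp E 2 m) (s : J → Ω → ℂ) (hs : ∀ j, MemLp (s j) ∞ m)
    (hU : ∀ j, ∀ v ∈ LinearMap.eqLocus (P : V →ₗ[ℂ] V) LinearMap.id, U (T j v) = (hs j).toLp (s j) • U v)
    (hline : ∀ c : J → ℂ, m {x | ∀ j, s j x = c j} = 0)
    (Ln : Submodule ℂ V) (hLnP : ∀ v ∈ Ln, P v = v)
    (hLnU : ∀ v ∈ Ln, ∀ y ∈ LinearMap.eqLocus (P : V →ₗ[ℂ] V) LinearMap.id, U y = 0 → ⟪v, y⟫_ℂ = 0)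
    (W : ClosedSubrep π) (hW : W.toContRep.IsTopIrreducible) :
    W.toSubmodule ≤ Lnᗮ := by
  intro y hy
  rw [Submodule.mem_orthogonal]
  intro v hv
  -- D5′: the line coordinate of `P y` vanishes
  have hD5 : U (P y) = 0 :=
    lpModel_blockProj_eq_zero_of_irreducible_subrep_cm_of_conv π hu hc νinf νf κ hκ μK χ e hχconv hχinv K' he0 he1 heK hestar P hPdef W hW T hT𝓐 hTP hTB U s hs hU hline hy
  -- `P y ∈ V_P` and `P` is self-adjoint
  have hPV : P y ∈ LinearMap.eqLocus (P : V →ₗ[ℂ] V) LinearMap.id := by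
    subst hPdef
    exact cm_blockProjector_hPV_of_conv π hu hc νf κ hκ μK χ e hχconv K' he0 he1 heK y
  have hPsa : ⟪P v, y⟫_ℂ = ⟪v, P y⟫_ℂ := by
    subst hPdef
    exact cm_blockProjector_hPsa π hu hc νf κ hκ μK χ e hχinv hestar v y
  rw [← hLnP v hv, hPsa]
  exact hLnU v hv (P y) hPV hD5

end Generic

/-! ## §2 The (N_blk,₃) clause of ★ F1_qs at Mok's `U(J₃) = quasiSplit L⁺ L c 3`, arbitrary level datum `(K′, ω)` and line space `Ln` — CONVOLUTION EDITION -/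

section Print

variable (L : Type) [Field L] [NumberField L] [IsCMField L]
  (μ : Measure (quasiSplit (↥(maximalRealSubfield L)) L (IsCMField.complexConj L) 3).automorphicQuotient)
  [(quasiSplit (↥(maximalRealSubfield L)) L (IsCMField.complexConj L) 3).IsAutomorphicMeasure μ]
  {K : Type*} [Group K] [TopologicalSpace K] [IsTopologicalGroup K] [MeasurableSpace K] [BorelSpace K] [SecondCountableTopology K]
  [MeasurableSpace (UnitaryGroup.arch (↥(maximalRealSubfield L)) L (IsCMField.complexConj L) 3 ((StdForm.antidiagonal 3).over L))] [BorelSpace (UnitaryGroup.arch (↥(maximalRealSubfield L)) L (IsCMField.complexConj L) 3 ((StdForm.antidiagonal 3).over L))]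
  [MeasurableSpace (finAdelic (↥(maximalRealSubfield L)) L (IsCMField.complexConj L) 3 ((StdForm.antidiagonal 3).over L))] [BorelSpace (finAdelic (↥(maximalRealSubfield L)) L (IsCMField.complexConj L) 3 ((StdForm.antidiagonal 3).over L))]
  (νinf : Measure (UnitaryGroup.arch (↥(maximalRealSubfield L)) L (IsCMField.complexConj L) 3 ((StdForm.antidiagonal 3).over L))) [IsFiniteMeasureOnCompacts νinf] [νinf.IsMulLeftInvariant] [νinf.IsInvInvariant] [νinf.IsOpenPosMeasure]
  (νf : Measure (finAdelic (↥(maximalRealSubfield L)) L (IsCMField.complexConj L) 3 ((StdForm.antidiagonal 3).over L))) [IsFiniteMeasureOnCompacts νf] [νf.IsMulLeftInvariant] [νf.IsInvInvariant] [νf.IsOpenPosMeasure]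
  (κ : K →* UnitaryGroup.arch (↥(maximalRealSubfield L)) L (IsCMField.complexConj L) 3 ((StdForm.antidiagonal 3).over L)) (hκ : Continuous κ)
  (μK : Measure K) [IsFiniteMeasureOnCompacts μK] [IsProbabilityMeasure μK] [μK.IsMulLeftInvariant] [MeasurableInv K] [μK.IsInvInvariant]
  (χ : C_c(K, ℂ)) (e : C_c(finAdelic (↥(maximalRealSubfield L)) L (IsCMField.complexConj L) 3 ((StdForm.antidiagonal 3).over L), ℂ))
  {Ω : Type*} {mΩ : MeasurableSpace Ω} (m : Measure Ω) {E : Type*} [NormedAddCommGroup E] [NormedSpace ℂ E] {J : Type*} [Countable J]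
variable [ENNReal.HolderTriple ∞ 2 2]

/-- **(N_blk,₃) — THE `hN` CLAUSE OF ★ F1_qs at an arbitrary level datum `(K′, ω)` and an arbitrary line space `Ln`, CONVOLUTION EDITION** of ★ `resG_isotypic_le_orthogonal_of_lineModel`
(K2E1-p12 (g4)): for Mok's `U(J₃) = quasiSplit L⁺ L c 3`, any `𝔓`, any `K′ ≤ U(J₃)(𝔸)` with a character `ω`, given the D5′ data∕letters of a block with a CONVOLUTION-IDEMPOTENT K-type
kernel `χ` (`hχconv`, `hχinv` — e.g. `χ_τ♮` of a `K_∞`-type `τ` of any dimension) and a line space `Ln` inside `V_P` detected by the line coordinate (`hLnP`, `hLnU`): every topologically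
irreducible closed `W′ ≤ L²_res(U(J₃), 𝔓)` has `W′ ∩ Iso(K′, ω) ⟂ Ln` (§1 at `π := R`; `(quasiSplit L⁺ L c 3).Adelic = (cmDatum L 3 ((antidiagonal 3).over L)).Adelic` definitionally).
[cite: MoeglinWaldspurger1995, I.2.18, IV.3.12, V.3.13, VI.2] [cite: Rogawski1990, §13.9 p. 229] [cite: ReedSimonI1980, Thm. II.3] -/
theorem resG_isotypic_le_orthogonal_of_lineModel_of_conv
    (𝔓 : (quasiSplit (↥(maximalRealSubfield L)) L (IsCMField.complexConj L) 3).ParabolicUnipotentData)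
    (K' : Subgroup (quasiSplit (↥(maximalRealSubfield L)) L (IsCMField.complexConj L) 3).Adelic) (ω : ↥K' →* ℂ)
    (hχconv : ∀ x, χ x = mulConv μK (⇑χ) (⇑χ) x) (hχinv : ∀ k, conj (χ k⁻¹) = χ k)
    (K'f : Subgroup (finAdelic (↥(maximalRealSubfield L)) L (IsCMField.complexConj L) 3 ((StdForm.antidiagonal 3).over L))) (he0 : ∀ x, x ∉ K'f → e x = 0) (he1 : ∫ x, e x ∂νf = 1)
    (heK : ∀ k ∈ K'f, ∀ x, e (k * x) = e x) (hestar : ∀ x, mulStar (⇑e) x = e x)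
    (P : (quasiSplit (↥(maximalRealSubfield L)) L (IsCMField.complexConj L) 3).L2 μ →L[ℂ] (quasiSplit (↥(maximalRealSubfield L)) L (IsCMField.complexConj L) 3).L2 μ)
    (hPdef : P = ((((quasiSplit (↥(maximalRealSubfield L)) L (IsCMField.complexConj L) 3).rightRegular μ).restrict ((archToAdelic (↥(maximalRealSubfield L)) L (IsCMField.complexConj L) 3 ((StdForm.antidiagonal 3).over L)).comp κ)).integratedOperator (((quasiSplit (↥(maximalRealSubfield L)) L (IsCMField.complexConj L) 3).isUnitary_rightRegular μ).restrict _)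
          (((quasiSplit (↥(maximalRealSubfield L)) L (IsCMField.complexConj L) 3).isStronglyContinuous_rightRegular_holds μ).restrict _ ((continuous_archToAdelic (↥(maximalRealSubfield L)) L (IsCMField.complexConj L) 3 ((StdForm.antidiagonal 3).over L)).comp hκ)) μK χ ∘L
        (((quasiSplit (↥(maximalRealSubfield L)) L (IsCMField.complexConj L) 3).rightRegular μ).restrict (finAdelicToAdelic (↥(maximalRealSubfield L)) L (IsCMField.complexConj L) 3 ((StdForm.antidiagonal 3).over L))).integratedOperator (((quasiSplit (↥(maximalRealSubfield L)) L (IsCMField.complexConj L) 3).isUnitary_rightRegular μ).restrict _) (((quasiSplit (↥(maximalRealSubfield L)) L (IsCMField.complexConj L) 3).isStronglyContinuous_rightRegular_holds μ).restrict _ (continuous_finAdelicToAdelic (↥(maximalRealSubfield L)) L (IsCMField.complexConj L) 3 ((StdForm.antidiagonal 3).over L))) νf e))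
    (T : J → (quasiSplit (↥(maximalRealSubfield L)) L (IsCMField.complexConj L) 3).L2 μ →L[ℂ] (quasiSplit (↥(maximalRealSubfield L)) L (IsCMField.complexConj L) 3).L2 μ)
    (hT𝓐 : ∀ j, T j ∈ {A' : (quasiSplit (↥(maximalRealSubfield L)) L (IsCMField.complexConj L) 3).L2 μ →L[ℂ] (quasiSplit (↥(maximalRealSubfield L)) L (IsCMField.complexConj L) 3).L2 μ | ∃ (a : C_c(UnitaryGroup.arch (↥(maximalRealSubfield L)) L (IsCMField.complexConj L) 3 ((StdForm.antidiagonal 3).over L), ℂ)) (b : C_c(finAdelic (↥(maximalRealSubfield L)) L (IsCMField.complexConj L) 3 ((StdForm.antidiagonal 3).over L), ℂ)),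
      A' = (((quasiSplit (↥(maximalRealSubfield L)) L (IsCMField.complexConj L) 3).rightRegular μ).restrict (archToAdelic (↥(maximalRealSubfield L)) L (IsCMField.complexConj L) 3 ((StdForm.antidiagonal 3).over L))).integratedOperator (((quasiSplit (↥(maximalRealSubfield L)) L (IsCMField.complexConj L) 3).isUnitary_rightRegular μ).restrict _) (((quasiSplit (↥(maximalRealSubfield L)) L (IsCMField.complexConj L) 3).isStronglyContinuous_rightRegular_holds μ).restrict _ (continuous_archToAdelic (↥(maximalRealSubfield L)) L (IsCMField.complexConj L) 3 ((StdForm.antidiagonal 3).over L))) νinf a ∘L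
          (((quasiSplit (↥(maximalRealSubfield L)) L (IsCMField.complexConj L) 3).rightRegular μ).restrict (finAdelicToAdelic (↥(maximalRealSubfield L)) L (IsCMField.complexConj L) 3 ((StdForm.antidiagonal 3).over L))).integratedOperator (((quasiSplit (↥(maximalRealSubfield L)) L (IsCMField.complexConj L) 3).isUnitary_rightRegular μ).restrict _) (((quasiSplit (↥(maximalRealSubfield L)) L (IsCMField.complexConj L) 3).isStronglyContinuous_rightRegular_holds μ).restrict _ (continuous_finAdelicToAdelic (↥(maximalRealSubfield L)) L (IsCMField.complexConj L) 3 ((StdForm.antidiagonal 3).over L))) νf b})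
    (hTP : ∀ j, Commute P (T j))
    (hTB : ∀ j, ∀ A' ∈ {A' : (quasiSplit (↥(maximalRealSubfield L)) L (IsCMField.complexConj L) 3).L2 μ →L[ℂ] (quasiSplit (↥(maximalRealSubfield L)) L (IsCMField.complexConj L) 3).L2 μ | ∃ (a : C_c(UnitaryGroup.arch (↥(maximalRealSubfield L)) L (IsCMField.complexConj L) 3 ((StdForm.antidiagonal 3).over L), ℂ)) (b : C_c(finAdelic (↥(maximalRealSubfield L)) L (IsCMField.complexConj L) 3 ((StdForm.antidiagonal 3).over L), ℂ)),
      A' = (((quasiSplit (↥(maximalRealSubfield L)) L (IsCMField.complexConj L) 3).rightRegular μ).restrict (archToAdelic (↥(maximalRealSubfield L)) L (IsCMField.complexConj L) 3 ((StdForm.antidiagonal 3).over L))).integratedOperator (((quasiSplit (↥(maximalRealSubfield L)) L (IsCMField.complexConj L) 3).isUnitary_rightRegular μ).restrict _) (((quasiSplit (↥(maximalRealSubfield L)) L (IsCMField.complexConj L) 3).isStronglyContinuous_rightRegular_holds μ).restrict _ (continuous_archToAdelic (↥(maximalRealSubfield L)) L (IsCMField.complexConj L) 3 ((StdForm.antidiagonal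 3).over L))) νinf a ∘L
          (((quasiSplit (↥(maximalRealSubfield L)) L (IsCMField.complexConj L) 3).rightRegular μ).restrict (finAdelicToAdelic (↥(maximalRealSubfield L)) L (IsCMField.complexConj L) 3 ((StdForm.antidiagonal 3).over L))).integratedOperator (((quasiSplit (↥(maximalRealSubfield L)) L (IsCMField.complexConj L) 3).isUnitary_rightRegular μ).restrict _) (((quasiSplit (↥(maximalRealSubfield L)) L (IsCMField.complexConj L) 3).isStronglyContinuous_rightRegular_holds μ).restrict _ (continuous_finAdelicToAdelic (↥(maximalRealSubfield L)) L (IsCMField.complexConj L) 3 ((StdForm.antidiagonal 3).over L))) νf b},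
      ∀ x ∈ LinearMap.eqLocus (P : (quasiSplit (↥(maximalRealSubfield L)) L (IsCMField.complexConj L) 3).L2 μ →ₗ[ℂ] (quasiSplit (↥(maximalRealSubfield L)) L (IsCMField.complexConj L) 3).L2 μ) LinearMap.id, P (A' (T j x)) = T j (P (A' x)))
    (U : (quasiSplit (↥(maximalRealSubfield L)) L (IsCMField.complexConj L) 3).L2 μ →ₗ[ℂ] Lp E 2 m) (s : J → Ω → ℂ) (hs : ∀ j, MemLp (s j) ∞ m)
    (hU : ∀ j, ∀ v ∈ LinearMap.eqLocus (P : (quasiSplit (↥(maximalRealSubfield L)) L (IsCMField.complexConj L) 3).L2 μ →ₗ[ℂ] (quasiSplit (↥(maximalRealSubfield L)) L (IsCMField.complexConj L) 3).L2 μ) LinearMap.id, U (T j v) = (hs j).toLp (s j) • U v)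
    (hline : ∀ c : J → ℂ, m {x | ∀ j, s j x = c j} = 0)
    (Ln : Submodule ℂ ((quasiSplit (↥(maximalRealSubfield L)) L (IsCMField.complexConj L) 3).L2 μ)) (hLnP : ∀ v ∈ Ln, P v = v)
    (hLnU : ∀ v ∈ Ln, ∀ y ∈ LinearMap.eqLocus (P : (quasiSplit (↥(maximalRealSubfield L)) L (IsCMField.complexConj L) 3).L2 μ →ₗ[ℂ] (quasiSplit (↥(maximalRealSubfield L)) L (IsCMField.complexConj L) 3).L2 μ) LinearMap.id, U y = 0 → ⟪v, y⟫_ℂ = 0) :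
    ∀ W' : ClosedSubrep ((quasiSplit (↥(maximalRealSubfield L)) L (IsCMField.complexConj L) 3).rightRegular μ), W'.toContRep.IsTopIrreducible →
      W' ≤ residualSubspace (quasiSplit (↥(maximalRealSubfield L)) L (IsCMField.complexConj L) 3) μ 𝔓 →
        W'.toSubmodule ⊓ (⨅ k : ↥K', Module.End.eigenspace ((((quasiSplit (↥(maximalRealSubfield L)) L (IsCMField.complexConj L) 3).rightRegular μ) (K'.subtype k) : (quasiSplit (↥(maximalRealSubfield L)) L (IsCMField.complexConj L) 3).L2 μ →L[ℂ] (quasiSplit (↥(maximalRealSubfield L)) L (IsCMField.complexConj L) 3).L2 μ) :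
          (quasiSplit (↥(maximalRealSubfield L)) L (IsCMField.complexConj L) 3).L2 μ →ₗ[ℂ] (quasiSplit (↥(maximalRealSubfield L)) L (IsCMField.complexConj L) 3).L2 μ) (ω k)) ≤ Lnᗮ := by
  intro W' hW' _
  -- `(quasiSplit L⁺ L c 3).Adelic = (cmDatum L 3 ((antidiagonal 3).over L)).Adelic` definitionally (★ `adelic_complexConj`): ★ §1 (every `N`) at `π := R`
  exact inf_le_left.trans
    (subrep_le_orthogonal_of_lineModel_cm_of_conv (H := (StdForm.antidiagonal 3).over L) ((quasiSplit (↥(maximalRealSubfield L)) L (IsCMField.complexConj L) 3).rightRegular μ)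
      ((quasiSplit (↥(maximalRealSubfield L)) L (IsCMField.complexConj L) 3).isUnitary_rightRegular μ)
      ((quasiSplit (↥(maximalRealSubfield L)) L (IsCMField.complexConj L) 3).isStronglyContinuous_rightRegular_holds μ) νinf νf κ hκ μK χ e m hχconv hχinv K'f he0 he1 heK
      hestar P hPdef T hT𝓐 hTP hTB U s hs hU hline Ln hLnP hLnU W' hW')

end Print

/-! ## §3 The (N_blk,₃) clause BY NAME at the line space of record `Ln := R90.S8.resGLine L μ U′ K′ ω χ₁ χ₂` — CONVOLUTION EDITION -/

section ByName

open Literature.NumberTheory.GaloisRepresentations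

variable (L : Type) [Field L] [NumberField L] [IsCMField L]
  (μ : Measure (quasiSplit (↥(maximalRealSubfield L)) L (IsCMField.complexConj L) 3).automorphicQuotient)
  [(quasiSplit (↥(maximalRealSubfield L)) L (IsCMField.complexConj L) 3).IsAutomorphicMeasure μ]
  {K : Type*} [Group K] [TopologicalSpace K] [IsTopologicalGroup K] [MeasurableSpace K] [BorelSpace K] [SecondCountableTopology K]
  [MeasurableSpace (UnitaryGroup.arch (↥(maximalRealSubfield L)) L (IsCMField.complexConj L) 3 ((StdForm.antidiagonal 3).over L))] [BorelSpace (UnitaryGroup.arch (↥(maximalRealSubfield L)) L (IsCMField.complexConj L) 3 ((StdForm.antidiagonal 3).over L))]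
  [MeasurableSpace (finAdelic (↥(maximalRealSubfield L)) L (IsCMField.complexConj L) 3 ((StdForm.antidiagonal 3).over L))] [BorelSpace (finAdelic (↥(maximalRealSubfield L)) L (IsCMField.complexConj L) 3 ((StdForm.antidiagonal 3).over L))]
  (νinf : Measure (UnitaryGroup.arch (↥(maximalRealSubfield L)) L (IsCMField.complexConj L) 3 ((StdForm.antidiagonal 3).over L))) [IsFiniteMeasureOnCompacts νinf] [νinf.IsMulLeftInvariant] [νinf.IsInvInvariant] [νinf.IsOpenPosMeasure]
  (νf : Measure (finAdelic (↥(maximalRealSubfield L)) L (IsCMField.complexConj L) 3 ((StdForm.antidiagonal 3).over L))) [IsFiniteMeasureOnCompacts νf] [νf.IsMulLeftInvariant] [νf.IsInvInvariant] [νf.IsOpenPosMeasure]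
  (κ : K →* UnitaryGroup.arch (↥(maximalRealSubfield L)) L (IsCMField.complexConj L) 3 ((StdForm.antidiagonal 3).over L)) (hκ : Continuous κ)
  (μK : Measure K) [IsFiniteMeasureOnCompacts μK] [IsProbabilityMeasure μK] [μK.IsMulLeftInvariant] [MeasurableInv K] [μK.IsInvInvariant]
  (χ : C_c(K, ℂ)) (e : C_c(finAdelic (↥(maximalRealSubfield L)) L (IsCMField.complexConj L) 3 ((StdForm.antidiagonal 3).over L), ℂ))
  {A M : Type*} [AddCommGroup A] [Module ℂ A] [AddCommGroup M] [Module ℂ M]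
  {Ω : Type*} {mΩ : MeasurableSpace Ω} (m : Measure Ω) {E : Type*} [NormedAddCommGroup E] [NormedSpace ℂ E] {J : Type*} [Countable J]
variable [ENNReal.HolderTriple ∞ 2 2]

/-- **(N_blk,₃) BY NAME at the LINE SPACE OF RECORD `resGLine L μ U′ K′ ω χ₁ χ₂`, CONVOLUTION EDITION** of ★ `resG_isotypic_le_orthogonal_lines` (K2E1-p12 (g4)): §2 at `U := snd ∘ U′`
for the three-slot block-model coordinate `U′ : L² →ₗ[ℂ] (A × M) × L²(Ω; E)` (★ G-DEFS `resGBlock ∕ resGAtom ∕ resGLine`), the interface letters discharged by ★ `resGLine_le_resGBlock`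
(`hLnP` from the visible `hScP : resGBlock ≤ V_P` — for the τ-cut block the payer is F0P2-p10 (g4)'s `hScP_tauCut_of_record` over FILE A's «`R_K(χ_τ♮) = id` on `N_τ`») and ★
`inner_eq_zero_of_mem_resGLine` at `y := P_{Sc} x` with the visible `hUker : Scᗮ ≤ ker U′`.  The K-type kernel `χ` is only assumed CONVOLUTION-IDEMPOTENT (`hχconv`, `hχinv`); remaining
visible bill IDENTICAL to ★'s (D5′'s `(κ, μK, χ; e, K′_f)`, `hPdef`, (L1), (L2) `U′ s hs hU`, (L3) `hline`, `hScP`, `hUker`). [cite: MoeglinWaldspurger1995, I.2.18, IV.3.12, V.3.13, VI.2]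
[cite: Rogawski1990, §13.9 p. 229] [cite: ReedSimonI1980, Thm. II.3] -/
theorem resG_isotypic_le_orthogonal_lines_of_conv
    (𝔓 : (quasiSplit (↥(maximalRealSubfield L)) L (IsCMField.complexConj L) 3).ParabolicUnipotentData)
    (K' : Subgroup (quasiSplit (↥(maximalRealSubfield L)) L (IsCMField.complexConj L) 3).Adelic) (ω : ↥K' →* ℂ)
    (χ₁ : HeckeCharacter L) (χ₂ : ↥(TorusDict.torus (IsCMField.complexConj L)) →ₜ* ℂˣ)
    (hχconv : ∀ x, χ x = mulConv μK (⇑χ) (⇑χ) x) (hχinv : ∀ k, conj (χ k⁻¹) = χ k)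
    (K'f : Subgroup (finAdelic (↥(maximalRealSubfield L)) L (IsCMField.complexConj L) 3 ((StdForm.antidiagonal 3).over L))) (he0 : ∀ x, x ∉ K'f → e x = 0) (he1 : ∫ x, e x ∂νf = 1)
    (heK : ∀ k ∈ K'f, ∀ x, e (k * x) = e x) (hestar : ∀ x, mulStar (⇑e) x = e x)
    (P : (quasiSplit (↥(maximalRealSubfield L)) L (IsCMField.complexConj L) 3).L2 μ →L[ℂ] (quasiSplit (↥(maximalRealSubfield L)) L (IsCMField.complexConj L) 3).L2 μ)
    (hPdef : P = ((((quasiSplit (↥(maximalRealSubfield L)) L (IsCMField.complexConj L) 3).rightRegular μ).restrict ((archToAdelic (↥(maximalRealSubfield L)) L (IsCMField.complexConj L) 3 ((StdForm.antidiagonal 3).over L)).comp κ)).integratedOperator (((quasiSplit (↥(maximalRealSubfield L)) L (IsCMField.complexConj L) 3).isUnitary_rightRegular μ).restrict _)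
          (((quasiSplit (↥(maximalRealSubfield L)) L (IsCMField.complexConj L) 3).isStronglyContinuous_rightRegular_holds μ).restrict _ ((continuous_archToAdelic (↥(maximalRealSubfield L)) L (IsCMField.complexConj L) 3 ((StdForm.antidiagonal 3).over L)).comp hκ)) μK χ ∘L
        (((quasiSplit (↥(maximalRealSubfield L)) L (IsCMField.complexConj L) 3).rightRegular μ).restrict (finAdelicToAdelic (↥(maximalRealSubfield L)) L (IsCMField.complexConj L) 3 ((StdForm.antidiagonal 3).over L))).integratedOperator (((quasiSplit (↥(maximalRealSubfield L)) L (IsCMField.complexConj L) 3).isUnitary_rightRegular μ).restrict _) (((quasiSplit (↥(maximalRealSubfield L)) L (IsCMField.complexConj L) 3).isStronglyContinuous_rightRegular_holds μ).restrict _ (continuous_finAdelicToAdelic (↥(maximalRealSubfield L)) L (IsCMField.complexConj L) 3 ((StdForm.antidiagonal 3).over L))) νf e))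
    (T : J → (quasiSplit (↥(maximalRealSubfield L)) L (IsCMField.complexConj L) 3).L2 μ →L[ℂ] (quasiSplit (↥(maximalRealSubfield L)) L (IsCMField.complexConj L) 3).L2 μ)
    (hT𝓐 : ∀ j, T j ∈ {A' : (quasiSplit (↥(maximalRealSubfield L)) L (IsCMField.complexConj L) 3).L2 μ →L[ℂ] (quasiSplit (↥(maximalRealSubfield L)) L (IsCMField.complexConj L) 3).L2 μ | ∃ (a : C_c(UnitaryGroup.arch (↥(maximalRealSubfield L)) L (IsCMField.complexConj L) 3 ((StdForm.antidiagonal 3).over L), ℂ)) (b : C_c(finAdelic (↥(maximalRealSubfield L)) L (IsCMField.complexConj L) 3 ((StdForm.antidiagonal 3).over L), ℂ)),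
      A' = (((quasiSplit (↥(maximalRealSubfield L)) L (IsCMField.complexConj L) 3).rightRegular μ).restrict (archToAdelic (↥(maximalRealSubfield L)) L (IsCMField.complexConj L) 3 ((StdForm.antidiagonal 3).over L))).integratedOperator (((quasiSplit (↥(maximalRealSubfield L)) L (IsCMField.complexConj L) 3).isUnitary_rightRegular μ).restrict _) (((quasiSplit (↥(maximalRealSubfield L)) L (IsCMField.complexConj L) 3).isStronglyContinuous_rightRegular_holds μ).restrict _ (continuous_archToAdelic (↥(maximalRealSubfield L)) L (IsCMField.complexConj L) 3 ((StdForm.antidiagonal 3).over L))) νinf a ∘L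
          (((quasiSplit (↥(maximalRealSubfield L)) L (IsCMField.complexConj L) 3).rightRegular μ).restrict (finAdelicToAdelic (↥(maximalRealSubfield L)) L (IsCMField.complexConj L) 3 ((StdForm.antidiagonal 3).over L))).integratedOperator (((quasiSplit (↥(maximalRealSubfield L)) L (IsCMField.complexConj L) 3).isUnitary_rightRegular μ).restrict _) (((quasiSplit (↥(maximalRealSubfield L)) L (IsCMField.complexConj L) 3).isStronglyContinuous_rightRegular_holds μ).restrict _ (continuous_finAdelicToAdelic (↥(maximalRealSubfield L)) L (IsCMField.complexConj L) 3 ((StdForm.antidiagonal 3).over L))) νf b})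
    (hTP : ∀ j, Commute P (T j))
    (hTB : ∀ j, ∀ A' ∈ {A' : (quasiSplit (↥(maximalRealSubfield L)) L (IsCMField.complexConj L) 3).L2 μ →L[ℂ] (quasiSplit (↥(maximalRealSubfield L)) L (IsCMField.complexConj L) 3).L2 μ | ∃ (a : C_c(UnitaryGroup.arch (↥(maximalRealSubfield L)) L (IsCMField.complexConj L) 3 ((StdForm.antidiagonal 3).over L), ℂ)) (b : C_c(finAdelic (↥(maximalRealSubfield L)) L (IsCMField.complexConj L) 3 ((StdForm.antidiagonal 3).over L), ℂ)),
      A' = (((quasiSplit (↥(maximalRealSubfield L)) L (IsCMField.complexConj L) 3).rightRegular μ).restrict (archToAdelic (↥(maximalRealSubfield L)) L (IsCMField.complexConj L) 3 ((StdForm.antidiagonal 3).over L))).integratedOperator (((quasiSplit (↥(maximalRealSubfield L)) L (IsCMField.complexConj L) 3).isUnitary_rightRegular μ).restrict _) (((quasiSplit (↥(maximalRealSubfield L)) L (IsCMField.complexConj L) 3).isStronglyContinuous_rightRegular_holds μ).restrict _ (continuous_archToAdelic (↥(maximalRealSubfield L)) L (IsCMField.complexConj L) 3 ((StdForm.antidiagonal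 3).over L))) νinf a ∘L
          (((quasiSplit (↥(maximalRealSubfield L)) L (IsCMField.complexConj L) 3).rightRegular μ).restrict (finAdelicToAdelic (↥(maximalRealSubfield L)) L (IsCMField.complexConj L) 3 ((StdForm.antidiagonal 3).over L))).integratedOperator (((quasiSplit (↥(maximalRealSubfield L)) L (IsCMField.complexConj L) 3).isUnitary_rightRegular μ).restrict _) (((quasiSplit (↥(maximalRealSubfield L)) L (IsCMField.complexConj L) 3).isStronglyContinuous_rightRegular_holds μ).restrict _ (continuous_finAdelicToAdelic (↥(maximalRealSubfield L)) L (IsCMField.complexConj L) 3 ((StdForm.antidiagonal 3).over L))) νf b},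
      ∀ x ∈ LinearMap.eqLocus (P : (quasiSplit (↥(maximalRealSubfield L)) L (IsCMField.complexConj L) 3).L2 μ →ₗ[ℂ] (quasiSplit (↥(maximalRealSubfield L)) L (IsCMField.complexConj L) 3).L2 μ) LinearMap.id, P (A' (T j x)) = T j (P (A' x)))
    (U' : (quasiSplit (↥(maximalRealSubfield L)) L (IsCMField.complexConj L) 3).L2 μ →ₗ[ℂ] (A × M) × Lp E 2 m) (s : J → Ω → ℂ) (hs : ∀ j, MemLp (s j) ∞ m)
    (hU : ∀ j, ∀ v ∈ LinearMap.eqLocus (P : (quasiSplit (↥(maximalRealSubfield L)) L (IsCMField.complexConj L) 3).L2 μ →ₗ[ℂ] (quasiSplit (↥(maximalRealSubfield L)) L (IsCMField.complexConj L) 3).L2 μ) LinearMap.id, (U' (T j v)).2 = ((hs j).toLp (s j) • (U' v).2 : Lp E 2 m))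
    (hline : ∀ c : J → ℂ, m {x | ∀ j, s j x = c j} = 0)
    (hScP : resGBlock L μ K' ω χ₁ χ₂ ≤ LinearMap.eqLocus (P : (quasiSplit (↥(maximalRealSubfield L)) L (IsCMField.complexConj L) 3).L2 μ →ₗ[ℂ] (quasiSplit (↥(maximalRealSubfield L)) L (IsCMField.complexConj L) 3).L2 μ) LinearMap.id)
    (hUker : (resGBlock L μ K' ω χ₁ χ₂)ᗮ ≤ LinearMap.ker U') :
    ∀ W' : ClosedSubrep ((quasiSplit (↥(maximalRealSubfield L)) L (IsCMField.complexConj L) 3).rightRegular μ), W'.toContRep.IsTopIrreducible →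
      W' ≤ residualSubspace (quasiSplit (↥(maximalRealSubfield L)) L (IsCMField.complexConj L) 3) μ 𝔓 →
        W'.toSubmodule ⊓ (⨅ k : ↥K', Module.End.eigenspace ((((quasiSplit (↥(maximalRealSubfield L)) L (IsCMField.complexConj L) 3).rightRegular μ) (K'.subtype k) : (quasiSplit (↥(maximalRealSubfield L)) L (IsCMField.complexConj L) 3).L2 μ →L[ℂ] (quasiSplit (↥(maximalRealSubfield L)) L (IsCMField.complexConj L) 3).L2 μ) :
          (quasiSplit (↥(maximalRealSubfield L)) L (IsCMField.complexConj L) 3).L2 μ →ₗ[ℂ] (quasiSplit (↥(maximalRealSubfield L)) L (IsCMField.complexConj L) 3).L2 μ) (ω k)) ≤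
          (resGLine L μ U' K' ω χ₁ χ₂)ᗮ := by
  -- the closed block is complete, so it has an orthogonal projection `P_{Sc}`
  haveI : CompleteSpace (resGBlock L μ K' ω χ₁ χ₂) := (isClosed_resGBlock L μ K' ω χ₁ χ₂).completeSpace_coe
  refine resG_isotypic_le_orthogonal_of_lineModel_of_conv L μ νinf νf κ hκ μK χ e m 𝔓 K' ω hχconv hχinv K'f he0 he1 heK hestar P hPdef T hT𝓐 hTP hTB
    ((LinearMap.snd ℂ (A × M) (Lp E 2 m)).comp U') s hs (fun j v hv => ?_) hline (resGLine L μ U' K' ω χ₁ χ₂) (fun v hv => ?_) (fun v hv y _ hUy => ?_)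
  · -- `hU` on the line coordinate
    simpa only [LinearMap.comp_apply, LinearMap.snd_apply] using hU j v hv
  · -- `hLnP`: `Ln ≤ Sc ≤ V_P`
    exact apply_eq_of_mem_eqLocus P v (hScP (resGLine_le_resGBlock L μ U' K' ω χ₁ χ₂ hv))
  · -- `hLnU`: ★ `inner_eq_zero_of_mem_resGLine` at `y₀ := P_{Sc} y`, with `U′ y₀ = U′ y` from `hUker`
    refine inner_eq_zero_of_mem_resGLine L μ U' K' ω χ₁ χ₂ hv y
      ⟨(resGBlock L μ K' ω χ₁ χ₂).starProjection y, Submodule.starProjection_apply_mem _ y, Submodule.sub_starProjection_mem_orthogonal y, ?_⟩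
    have hker : U' (y - (resGBlock L μ K' ω χ₁ χ₂).starProjection y) = 0 :=
      LinearMap.mem_ker.1 (hUker (Submodule.sub_starProjection_mem_orthogonal y))
    have hEq : U' ((resGBlock L μ K' ω χ₁ χ₂).starProjection y) = U' y := by
      rw [map_sub, sub_eq_zero] at hker
      exact hker.symm
    rw [hEq]
    simpa only [LinearMap.comp_apply, LinearMap.snd_apply] using hUy

end ByName

end Summit.HodgeConjecture.HodgeConjecture.R90.S8

end
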